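import Summits.AtomisticToContinuum.Crystallization.Theorems.HolmgrenBoyleLindPatchHull
import Summits.AtomisticToContinuum.Crystallization.Theorems.HolmgrenBoyleLindFiniteRigidityKernel

/-!
# Route `HolmgrenBoyleLind`: Lennard-Jones force fields of separated sources, part 1 —
summability off the source and the complexified kernel along a line

Support file for item stmt-AtomisticToContinuum-6079 (`FLCEquilibriumPeriodic`, equivalent to the
crux `HalfSpaceUniqueContinuation`, file `HolmgrenBoyleLindFLCEquilibriumPeriodicIffUC.lean`).
The planner's two-layer split of the crux is `UC ⇐ UCContinuum → UCDiscrete`, where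
`UCContinuum` says: if the signed difference force field of two hull elements vanishes on an OPEN
subset of the lower half-space then the two elements coincide. This file and its sequel
(`HolmgrenBoyleLindOpenVanishing.lean`) prove `UCContinuum` in the general form «a separated signed
Lennard-Jones source whose force field vanishes on a non-empty open set is empty».

The force field of an infinite `δ`-separated source `X ⊂ ℝ³` is `Φ_X(x) = Σ'_{y ∈ X} K(x − y)`,
`K(v) = ((‖v‖²)⁻⁴ − (‖v‖²)⁻⁷) v` (`ljForce_eq_kernel`). Instead of real-analyticity of `Φ_X` on
`ℝ³ ∖ X` (which would need several complex variables) we complexify ALONG LINES: for a base point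
`p`, a direction `v` and a test vector `e`, the summand `⟪e, K(p + s v − y)⟫` is the restriction to
real `s` of the rational function
`H_y(s) = ((Q_y(s))⁻⁴ − (Q_y(s))⁻⁷) (⟪e, p − y⟫ + s ⟪e, v⟫)`,
`Q_y(s) = ‖p − y‖² + 2 s ⟪p − y, v⟫ + s² ‖v‖²`, of ONE complex variable. Here:

* `hbl_exists_sum_inv_pow_seven_le`, `hbl_summable_inv_pow_seven` — the majorant
  `(max ρ (dist y p / 2 − L))⁻⁷` is summable over any `δ`-separated set (packing near `p`, the
  `r⁻⁷` shell bound `sum_inv_pow_le_of_separated` far away);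
* `hbl_summable_norm_ljForce_of_clear`, `hbl_exists_tsum_norm_ljForce_le_of_clear` — at a point at
  distance `≥ ρ` from a `δ`-separated `X` the forces are absolutely summable, with a bound depending
  on `δ, ρ` only;
* `hbl_lineQ_eq`, `hbl_norm_lineQ_ge`, `hbl_norm_lineH_le` — on the thin rectangle
  `a₁ < re s < a₂`, `|im s| < η` (`η‖v‖ ≤ ρ/2`, the real segment `ρ`-clear of the source),
  `|Q_y(s)| ≥ ‖p + (re s) v − y‖²/2` and `|H_y(s)| ≤ ‖e‖ (32 + 256 ρ⁻⁶) (max ρ (dist y p/2 − L))⁻⁷`;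
* `hbl_differentiableAt_lineH`, `hbl_lineH_ofReal` — `H_y` is holomorphic where `Q_y ≠ 0` and real
  on the real axis with value `⟪e, K(p + σ v − y)⟫`.

Part 2 sums over the source (`Complex.differentiableOn_tsum_of_summable_norm`), applies the
one-variable identity theorem along segments issuing from the open zero set, and concludes with the
`‖v‖⁻¹³` blow-up of `K` at a source point. All `[folklore]`; nothing here closes an item.
-/

noncomputable section

namespace Summit.AtomisticToContinuum.Crystallization.Theorems

open scoped BigOperators Topology InnerProductSpace
open Filter Set
open Literature.MathematicalPhysics.StatisticalMechanics
open Summit.AtomisticToContinuum.Crystallization.Theorems.ExcessDecayLiouville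
open Summit.AtomisticToContinuum.Crystallization.Theorems.HolmgrenBoyleLind

/-! ## A summable majorant over separated sets -/

/-- **Packing majorant.** For `δ, ρ > 0` and any real `L` there is a constant `B` such that over every
finite `δ`-separated `s ⊂ ℝ³` and for every centre `p`,
`Σ_{y ∈ s} (max ρ (dist y p / 2 − L))⁻⁷ ≤ B`: the points with `dist y p < R := max (4L) δ` number
`≤ (2R/δ + 1)³` and contribute `≤ ρ⁻⁷` each, the others have `max ρ (…) ≥ dist y p / 4` and the
shell bound `sum_inv_pow_le_of_separated` applies. [folklore] -/
theorem hbl_exists_sum_inv_pow_seven_le {δ ρ : ℝ} (L : ℝ) (hδ : 0 < δ) (hρ : 0 < ρ) :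
    ∃ B : ℝ, 0 ≤ B ∧ ∀ (s : Finset (EuclideanSpace ℝ (Fin 3))) (p : (EuclideanSpace ℝ (Fin 3))),
      (∀ a ∈ s, ∀ b ∈ s, a ≠ b → δ ≤ dist a b) →
      ∑ y ∈ s, ((max ρ (dist y p / 2 - L))⁻¹) ^ 7 ≤ B := by
  classical
  set R : ℝ := max (4 * L) δ with hR
  have hδR : δ ≤ R := le_max_right _ _
  have hRpos : 0 < R := hδ.trans_le hδR
  have h4L : 4 * L ≤ R := le_max_left _ _
  refine ⟨(2 * R / δ + 1) ^ 3 * (ρ⁻¹) ^ 7 + 16384 * (1024 / (δ ^ 3 * R ^ 4)), by positivity, ?_⟩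
  intro s p hsep
  rw [← Finset.sum_filter_add_sum_filter_not s (fun y => dist y p < R)]
  refine add_le_add ?_ ?_
  · -- near part: at most `(2R/δ + 1)³` points, each term `≤ ρ⁻⁷`
    have hterm : ∀ y ∈ s.filter (fun y => dist y p < R),
        ((max ρ (dist y p / 2 - L))⁻¹) ^ 7 ≤ (ρ⁻¹) ^ 7 := by
      intro y _
      have hm : ρ ≤ max ρ (dist y p / 2 - L) := le_max_left _ _
      have hmpos : 0 < max ρ (dist y p / 2 - L) := hρ.trans_le hm
      have hi : (max ρ (dist y p / 2 - L))⁻¹ ≤ ρ⁻¹ := (inv_le_inv₀ hmpos hρ).2 hm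
      have hi0 : 0 ≤ (max ρ (dist y p / 2 - L))⁻¹ := inv_nonneg.2 hmpos.le
      exact pow_le_pow_left₀ hi0 hi 7
    have hcard : ((s.filter (fun y => dist y p < R)).card : ℝ) ≤ (2 * R / δ + 1) ^ 3 := by
      have h := card_le_of_separated_of_dist_le (s.filter (fun y => dist y p < R)) p hδ hRpos.le
        (fun c hc => (Finset.mem_filter.1 hc).2.le)
        (fun c hc d hd hcd => hsep c (Finset.mem_filter.1 hc).1 d (Finset.mem_filter.1 hd).1 hcd)
      rwa [finrank_euclideanSpace_fin] at h
    refine (Finset.sum_le_sum hterm).trans ?_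
    rw [Finset.sum_const, nsmul_eq_mul]
    have h7 : 0 ≤ (ρ⁻¹) ^ 7 := by positivity
    exact mul_le_mul_of_nonneg_right hcard h7
  · -- far part: `max ρ (dist/2 − L) ≥ dist/4`, then the `r⁻⁷` shell bound
    have hterm : ∀ y ∈ s.filter (fun y => ¬ dist y p < R),
        ((max ρ (dist y p / 2 - L))⁻¹) ^ 7 ≤ 16384 * (dist y p)⁻¹ ^ (4 + 3) := by
      intro y hy
      have hfar : R ≤ dist y p := not_lt.1 (Finset.mem_filter.1 hy).2
      have hd : 0 < dist y p := hRpos.trans_le hfar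
      have hq : dist y p / 4 ≤ max ρ (dist y p / 2 - L) := by
        refine le_trans ?_ (le_max_right _ _)
        linarith
      have hq0 : 0 < dist y p / 4 := by positivity
      have hi : (max ρ (dist y p / 2 - L))⁻¹ ≤ (dist y p / 4)⁻¹ := (inv_le_inv₀ (hq0.trans_le hq) hq0).2 hq
      have hi0 : 0 ≤ (max ρ (dist y p / 2 - L))⁻¹ := inv_nonneg.2 (hq0.trans_le hq).le
      calc ((max ρ (dist y p / 2 - L))⁻¹) ^ 7 ≤ ((dist y p / 4)⁻¹) ^ 7 := pow_le_pow_left₀ hi0 hi 7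
        _ = 16384 * (dist y p)⁻¹ ^ (4 + 3) := by
            have h4 : (dist y p / 4)⁻¹ = 4 * (dist y p)⁻¹ := by
              rw [inv_div, div_eq_mul_inv]
            rw [h4, mul_pow]
            norm_num
    have hmain := sum_inv_pow_le_of_separated (s.filter (fun y => ¬ dist y p < R)) p (k := 4)
      (by norm_num) hδ hδR
      (fun a ha b hb hab => hsep a (Finset.mem_filter.1 ha).1 b (Finset.mem_filter.1 hb).1 hab)
      (fun a ha => not_lt.1 (Finset.mem_filter.1 ha).2)
    calc ∑ y ∈ s.filter (fun y => ¬ dist y p < R), ((max ρ (dist y p / 2 - L))⁻¹) ^ 7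
        ≤ ∑ y ∈ s.filter (fun y => ¬ dist y p < R), 16384 * (dist y p)⁻¹ ^ (4 + 3) :=
          Finset.sum_le_sum hterm
      _ = 16384 * ∑ y ∈ s.filter (fun y => ¬ dist y p < R), (dist y p)⁻¹ ^ (4 + 3) := by
          rw [Finset.mul_sum]
      _ ≤ 16384 * (1024 / (δ ^ 3 * R ^ 4)) := by gcongr

/-- The packing majorant `C · (max ρ (dist (g i) p / 2 − L))⁻⁷` is summable along any injective
family `g` with values in a `δ`-separated set. [folklore] -/
theorem hbl_summable_inv_pow_seven {ι : Type*} {X : Set (EuclideanSpace ℝ (Fin 3))} {δ ρ : ℝ} (L : ℝ)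
    (hδ : 0 < δ) (hρ : 0 < ρ)
    (hsep : ∀ a ∈ X, ∀ b ∈ X, a ≠ b → δ ≤ dist a b) (g : ι → (EuclideanSpace ℝ (Fin 3)))
    (hg : Function.Injective g) (hgX : ∀ i, g i ∈ X) (p : (EuclideanSpace ℝ (Fin 3))) {C : ℝ} (hC : 0 ≤ C) :
    Summable (fun i => C * ((max ρ (dist (g i) p / 2 - L))⁻¹) ^ 7) := by
  classical
  obtain ⟨B, -, hB⟩ := hbl_exists_sum_inv_pow_seven_le L hδ hρ
  have hnn : ∀ i, 0 ≤ C * ((max ρ (dist (g i) p / 2 - L))⁻¹) ^ 7 := fun i =>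
    mul_nonneg hC (pow_nonneg (inv_nonneg.2 (hρ.le.trans (le_max_left _ _))) 7)
  refine summable_of_sum_le hnn (c := C * B) fun u => ?_
  rw [← Finset.mul_sum]
  refine mul_le_mul_of_nonneg_left ?_ hC
  have h := hB (u.map ⟨g, hg⟩) p ?_
  · rwa [Finset.sum_map] at h
  · intro a ha b hb hab
    simp only [Finset.mem_map, Function.Embedding.coeFn_mk] at ha hb
    obtain ⟨i, -, rfl⟩ := ha
    obtain ⟨j, -, rfl⟩ := hb
    exact hsep _ (hgX i) _ (hgX j) hab

/-! ## Lennard-Jones forces at a point off the source -/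

/-- `‖(V′(d)/d)·(x − y)‖ ≤ (ρ⁻⁶ + 1) d⁻⁷` for `d = dist y x ≥ ρ > 0`. [folklore] -/
theorem hbl_norm_ljForce_le_of_le_dist {x y : (EuclideanSpace ℝ (Fin 3))} {ρ : ℝ} (hρ : 0 < ρ) (h : ρ ≤ dist y x) :
    ‖(deriv lennardJones (dist x y) / dist x y) • (x - y)‖ ≤ ((ρ⁻¹) ^ 6 + 1) * ((dist y x)⁻¹) ^ 7 := by
  have hd : 0 < dist y x := hρ.trans_le h
  have hne : x ≠ y := by
    intro hxy
    rw [hxy, dist_self] at hd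
    exact lt_irrefl _ hd
  rw [norm_ljForce_eq hne, dist_comm]
  refine (abs_deriv_lennardJones_le hd).trans ?_
  have hi : (dist y x)⁻¹ ≤ ρ⁻¹ := (inv_le_inv₀ hd hρ).2 h
  have hi0 : 0 ≤ (dist y x)⁻¹ := inv_nonneg.2 hd.le
  have h13 : (dist y x)⁻¹ ^ 13 = (dist y x)⁻¹ ^ 6 * (dist y x)⁻¹ ^ 7 := by ring
  rw [h13, add_mul, one_mul]
  have h6 : (dist y x)⁻¹ ^ 6 ≤ (ρ⁻¹) ^ 6 := pow_le_pow_left₀ hi0 hi 6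
  have h7 : 0 ≤ (dist y x)⁻¹ ^ 7 := by positivity
  nlinarith

/-- At distance `≥ ρ` the force norm is dominated by the packing majorant (with `L = 0`). [folklore] -/
theorem hbl_norm_ljForce_le_majorant {x y : (EuclideanSpace ℝ (Fin 3))} {ρ : ℝ} (hρ : 0 < ρ) (h : ρ ≤ dist y x) :
    ‖(deriv lennardJones (dist x y) / dist x y) • (x - y)‖ ≤
      ((ρ⁻¹) ^ 6 + 1) * ((max ρ (dist y x / 2 - 0))⁻¹) ^ 7 := by
  refine (hbl_norm_ljForce_le_of_le_dist hρ h).trans ?_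
  have hd : 0 < dist y x := hρ.trans_le h
  have hm : max ρ (dist y x / 2 - 0) ≤ dist y x := max_le h (by linarith)
  have hm0 : 0 < max ρ (dist y x / 2 - 0) := hρ.trans_le (le_max_left _ _)
  have hi : (dist y x)⁻¹ ≤ (max ρ (dist y x / 2 - 0))⁻¹ := (inv_le_inv₀ hd hm0).2 hm
  have hi0 : 0 ≤ (dist y x)⁻¹ := inv_nonneg.2 hd.le
  have hc : 0 ≤ (ρ⁻¹) ^ 6 + 1 := by positivity
  exact mul_le_mul_of_nonneg_left (pow_le_pow_left₀ hi0 hi 7) hc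

/-- **Absolute summability off the source.** Along an injective family `g` with values in a
`δ`-separated set, all at distance `≥ ρ > 0` from `x`, the Lennard-Jones forces on `x` are absolutely
summable. [folklore] -/
theorem hbl_summable_norm_ljForce_of_clear {ι : Type*} {X : Set (EuclideanSpace ℝ (Fin 3))} {δ ρ : ℝ} (hδ : 0 < δ)
    (hρ : 0 < ρ) (hsep : ∀ a ∈ X, ∀ b ∈ X, a ≠ b → δ ≤ dist a b) (g : ι → (EuclideanSpace ℝ (Fin 3)))
    (hg : Function.Injective g) (hgX : ∀ i, g i ∈ X) {x : (EuclideanSpace ℝ (Fin 3))} (hclear : ∀ i, ρ ≤ dist (g i) x) :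
    Summable (fun i => ‖(deriv lennardJones (dist x (g i)) / dist x (g i)) • (x - g i)‖) :=
  (hbl_summable_inv_pow_seven 0 hδ hρ hsep g hg hgX x (C := (ρ⁻¹) ^ 6 + 1)
    (by positivity)).of_nonneg_of_le (fun _ => norm_nonneg _)
    fun i => hbl_norm_ljForce_le_majorant hρ (hclear i)

/-- **Uniform bound off the source.** For `δ, ρ > 0` there is `M` such that along every injective
family `g` with values in a `δ`-separated set, all at distance `≥ ρ` from `x`,
`Σ' ‖(V′/d)·(x − g i)‖ ≤ M` (the bound does not depend on `x`, `X` or `g`). [folklore] -/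
theorem hbl_exists_tsum_norm_ljForce_le_of_clear {δ ρ : ℝ} (hδ : 0 < δ) (hρ : 0 < ρ) :
    ∃ M : ℝ, 0 ≤ M ∧ ∀ {ι : Type*} {X : Set (EuclideanSpace ℝ (Fin 3))},
      (∀ a ∈ X, ∀ b ∈ X, a ≠ b → δ ≤ dist a b) → ∀ (g : ι → (EuclideanSpace ℝ (Fin 3))), Function.Injective g →
      (∀ i, g i ∈ X) → ∀ x : (EuclideanSpace ℝ (Fin 3)), (∀ i, ρ ≤ dist (g i) x) →
      ∑' i, ‖(deriv lennardJones (dist x (g i)) / dist x (g i)) • (x - g i)‖ ≤ M := by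
  classical
  obtain ⟨B, hB0, hB⟩ := hbl_exists_sum_inv_pow_seven_le 0 hδ hρ
  refine ⟨((ρ⁻¹) ^ 6 + 1) * B, by positivity, ?_⟩
  intro ι X hsep g hg hgX x hclear
  refine (hbl_summable_norm_ljForce_of_clear hδ hρ hsep g hg hgX hclear).tsum_le_of_sum_le
    fun u => ?_
  calc ∑ i ∈ u, ‖(deriv lennardJones (dist x (g i)) / dist x (g i)) • (x - g i)‖
      ≤ ∑ i ∈ u, ((ρ⁻¹) ^ 6 + 1) * ((max ρ (dist (g i) x / 2 - 0))⁻¹) ^ 7 :=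
        Finset.sum_le_sum fun i _ => hbl_norm_ljForce_le_majorant hρ (hclear i)
    _ = ((ρ⁻¹) ^ 6 + 1) * ∑ i ∈ u, ((max ρ (dist (g i) x / 2 - 0))⁻¹) ^ 7 := by
        rw [Finset.mul_sum]
    _ ≤ ((ρ⁻¹) ^ 6 + 1) * B := by
        refine mul_le_mul_of_nonneg_left ?_ (by positivity)
        have h := hB (u.map ⟨g, hg⟩) x ?_
        · rwa [Finset.sum_map] at h
        · intro a ha b hb hab
          simp only [Finset.mem_map, Function.Embedding.coeFn_mk] at ha hb
          obtain ⟨i, -, rfl⟩ := ha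
          obtain ⟨j, -, rfl⟩ := hb
          exact hsep _ (hgX i) _ (hgX j) hab


/-! ## The complexified kernel along a line -/

/-- Real and imaginary parts of `Q(s) = ‖w‖² + 2 s ⟪w, v⟫ + s² ‖v‖²`:
`Q(σ + τ i) = (‖w + σ v‖² − ‖τ v‖²) + 2 ⟪w + σ v, τ v⟫ i`. [folklore] -/
theorem hbl_lineQ_eq (w v : (EuclideanSpace ℝ (Fin 3))) (s : ℂ) :
    ((‖w‖ ^ 2 : ℝ) : ℂ) + 2 * s * ((⟪w, v⟫_ℝ : ℝ) : ℂ) + s ^ 2 * ((‖v‖ ^ 2 : ℝ) : ℂ) =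
      ((‖w + s.re • v‖ ^ 2 - ‖s.im • v‖ ^ 2 : ℝ) : ℂ) +
        ((2 * ⟪w + s.re • v, s.im • v⟫_ℝ : ℝ) : ℂ) * Complex.I := by
  have h1 : ‖w + s.re • v‖ ^ 2 = ‖w‖ ^ 2 + 2 * (s.re * ⟪w, v⟫_ℝ) + s.re ^ 2 * ‖v‖ ^ 2 := by
    rw [norm_add_sq_real, real_inner_smul_right, norm_smul, mul_pow, Real.norm_eq_abs, sq_abs]
  have h2 : ‖s.im • v‖ ^ 2 = s.im ^ 2 * ‖v‖ ^ 2 := by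
    rw [norm_smul, mul_pow, Real.norm_eq_abs, sq_abs]
  have h3 : ⟪w + s.re • v, s.im • v⟫_ℝ = s.im * ⟪w, v⟫_ℝ + s.re * s.im * ‖v‖ ^ 2 := by
    rw [inner_add_left, real_inner_smul_left, real_inner_smul_right, real_inner_smul_right,
      real_inner_self_eq_norm_sq]
    ring
  rw [h1, h2, h3]
  conv_lhs => rw [← Complex.re_add_im s]
  push_cast
  linear_combination ((s.im : ℂ) ^ 2 * (‖v‖ : ℂ) ^ 2) * Complex.I_sq

/-- The numerator `⟪e, w⟫ + s ⟪e, v⟫` has real part `⟪e, w + σ v⟫` and imaginary part `⟪e, τ v⟫`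
(`s = σ + τ i`). [folklore] -/
theorem hbl_lineN_eq (w v e : (EuclideanSpace ℝ (Fin 3))) (s : ℂ) :
    ((⟪e, w⟫_ℝ : ℝ) : ℂ) + s * ((⟪e, v⟫_ℝ : ℝ) : ℂ) =
      ((⟪e, w + s.re • v⟫_ℝ : ℝ) : ℂ) + ((⟪e, s.im • v⟫_ℝ : ℝ) : ℂ) * Complex.I := by
  rw [inner_add_right, real_inner_smul_right, real_inner_smul_right]
  conv_lhs => rw [← Complex.re_add_im s]
  push_cast
  ring

/-- **No complex zeros near a clear segment.** If `‖w + σ v‖ ≥ ρ > 0` and `‖τ v‖ ≤ ρ/2` then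
`|Q(σ + τ i)| ≥ ‖w + σ v‖² / 2`. [folklore] -/
theorem hbl_norm_lineQ_ge {w v : (EuclideanSpace ℝ (Fin 3))} {ρ : ℝ} {s : ℂ} (ha : ρ ≤ ‖w + s.re • v‖)
    (hb : ‖s.im • v‖ ≤ ρ / 2) :
    ‖w + s.re • v‖ ^ 2 / 2 ≤
      ‖((‖w‖ ^ 2 : ℝ) : ℂ) + 2 * s * ((⟪w, v⟫_ℝ : ℝ) : ℂ) + s ^ 2 * ((‖v‖ ^ 2 : ℝ) : ℂ)‖ := by
  rw [hbl_lineQ_eq]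
  refine le_trans ?_ (Complex.re_le_norm _)
  have hre : (((‖w + s.re • v‖ ^ 2 - ‖s.im • v‖ ^ 2 : ℝ) : ℂ) +
      ((2 * ⟪w + s.re • v, s.im • v⟫_ℝ : ℝ) : ℂ) * Complex.I).re =
      ‖w + s.re • v‖ ^ 2 - ‖s.im • v‖ ^ 2 := by
    simp only [Complex.add_re, Complex.ofReal_re, Complex.mul_re, Complex.ofReal_im, Complex.I_re,
      Complex.I_im, mul_zero, zero_mul, sub_zero, add_zero]
  rw [hre]
  have hb' : ‖s.im • v‖ ≤ ‖w + s.re • v‖ / 2 := hb.trans (by linarith)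
  have hb0 : 0 ≤ ‖s.im • v‖ := norm_nonneg _
  have hsq : ‖s.im • v‖ ^ 2 ≤ (‖w + s.re • v‖ / 2) ^ 2 := pow_le_pow_left₀ hb0 hb' 2
  nlinarith [hsq, sq_nonneg ‖w + s.re • v‖]

/-- **Majorant of the complexified summand.** If `‖w + σ v‖ ≥ ρ > 0`, `‖w + σ v‖ ≥ m > 0` and
`‖τ v‖ ≤ ρ/2`, then `|H(σ + τ i)| ≤ ‖e‖ (32 + 256 ρ⁻⁶) m⁻⁷`, where
`H(s) = (Q(s)⁻⁴ − Q(s)⁻⁷)(⟪e, w⟫ + s ⟪e, v⟫)`. [folklore] -/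
theorem hbl_norm_lineH_le {w v e : (EuclideanSpace ℝ (Fin 3))} {ρ m : ℝ} (hρ : 0 < ρ) (hm : 0 < m) {s : ℂ}
    (ha : ρ ≤ ‖w + s.re • v‖) (hma : m ≤ ‖w + s.re • v‖) (hb : ‖s.im • v‖ ≤ ρ / 2) :
    ‖(((((‖w‖ ^ 2 : ℝ) : ℂ) + 2 * s * ((⟪w, v⟫_ℝ : ℝ) : ℂ) + s ^ 2 * ((‖v‖ ^ 2 : ℝ) : ℂ)) ^ 4)⁻¹ -
        ((((‖w‖ ^ 2 : ℝ) : ℂ) + 2 * s * ((⟪w, v⟫_ℝ : ℝ) : ℂ) + s ^ 2 * ((‖v‖ ^ 2 : ℝ) : ℂ)) ^ 7)⁻¹) *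
      (((⟪e, w⟫_ℝ : ℝ) : ℂ) + s * ((⟪e, v⟫_ℝ : ℝ) : ℂ))‖ ≤
      ‖e‖ * (32 + 256 * (ρ⁻¹) ^ 6) * (m⁻¹) ^ 7 := by
  set Q : ℂ := ((‖w‖ ^ 2 : ℝ) : ℂ) + 2 * s * ((⟪w, v⟫_ℝ : ℝ) : ℂ) + s ^ 2 * ((‖v‖ ^ 2 : ℝ) : ℂ)
    with hQdef
  set t : ℝ := ‖w + s.re • v‖ with htdef
  have ht : 0 < t := hρ.trans_le ha
  have hQ : t ^ 2 / 2 ≤ ‖Q‖ := hbl_norm_lineQ_ge ha hb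
  have hQpos : 0 < ‖Q‖ := lt_of_lt_of_le (by positivity) hQ
  set u : ℝ := t⁻¹ with hudef
  have hu0 : 0 ≤ u := inv_nonneg.2 ht.le
  have hut : u * t = 1 := inv_mul_cancel₀ ht.ne'
  have huρ : u ≤ ρ⁻¹ := (inv_le_inv₀ ht hρ).2 ha
  have hum : u ≤ m⁻¹ := (inv_le_inv₀ ht hm).2 hma
  -- the inverse powers of `Q`
  have hQinv : ‖Q‖⁻¹ ≤ 2 * u ^ 2 := by
    have h1 : ‖Q‖⁻¹ ≤ (t ^ 2 / 2)⁻¹ := (inv_le_inv₀ hQpos (by positivity)).2 hQ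
    have h2 : (t ^ 2 / 2)⁻¹ = 2 * u ^ 2 := by
      rw [hudef]
      field_simp
    rwa [h2] at h1
  have hQi0 : 0 ≤ ‖Q‖⁻¹ := inv_nonneg.2 hQpos.le
  have hK : ‖(Q ^ 4)⁻¹ - (Q ^ 7)⁻¹‖ ≤ 16 * u ^ 8 + 128 * u ^ 14 := by
    refine (norm_sub_le _ _).trans ?_
    rw [norm_inv, norm_inv, norm_pow, norm_pow, ← inv_pow, ← inv_pow]
    have h4 : ‖Q‖⁻¹ ^ 4 ≤ (2 * u ^ 2) ^ 4 := pow_le_pow_left₀ hQi0 hQinv 4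
    have h7 : ‖Q‖⁻¹ ^ 7 ≤ (2 * u ^ 2) ^ 7 := pow_le_pow_left₀ hQi0 hQinv 7
    calc ‖Q‖⁻¹ ^ 4 + ‖Q‖⁻¹ ^ 7 ≤ (2 * u ^ 2) ^ 4 + (2 * u ^ 2) ^ 7 := add_le_add h4 h7
      _ = 16 * u ^ 8 + 128 * u ^ 14 := by ring
  -- the numerator
  have hN : ‖((⟪e, w⟫_ℝ : ℝ) : ℂ) + s * ((⟪e, v⟫_ℝ : ℝ) : ℂ)‖ ≤ 2 * ‖e‖ * t := by
    rw [hbl_lineN_eq]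
    refine (Complex.norm_le_abs_re_add_abs_im _).trans ?_
    have hre : (((⟪e, w + s.re • v⟫_ℝ : ℝ) : ℂ) + ((⟪e, s.im • v⟫_ℝ : ℝ) : ℂ) * Complex.I).re =
        ⟪e, w + s.re • v⟫_ℝ := by
      simp [Complex.add_re, Complex.mul_re, Complex.ofReal_re, Complex.ofReal_im, Complex.I_re,
        Complex.I_im]
    have him : (((⟪e, w + s.re • v⟫_ℝ : ℝ) : ℂ) + ((⟪e, s.im • v⟫_ℝ : ℝ) : ℂ) * Complex.I).im =
        ⟪e, s.im • v⟫_ℝ := by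
      simp [Complex.add_im, Complex.mul_im, Complex.ofReal_re, Complex.ofReal_im, Complex.I_re,
        Complex.I_im]
    rw [hre, him]
    have h1 : |⟪e, w + s.re • v⟫_ℝ| ≤ ‖e‖ * t := abs_real_inner_le_norm _ _
    have h2 : |⟪e, s.im • v⟫_ℝ| ≤ ‖e‖ * ‖s.im • v‖ := abs_real_inner_le_norm _ _
    have h3 : ‖s.im • v‖ ≤ t := hb.trans (by linarith)
    have he : 0 ≤ ‖e‖ := norm_nonneg _
    nlinarith [mul_le_mul_of_nonneg_left h3 he]
  -- assemble
  rw [norm_mul]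
  have hKu0 : 0 ≤ 16 * u ^ 8 + 128 * u ^ 14 := by positivity
  calc ‖(Q ^ 4)⁻¹ - (Q ^ 7)⁻¹‖ * ‖((⟪e, w⟫_ℝ : ℝ) : ℂ) + s * ((⟪e, v⟫_ℝ : ℝ) : ℂ)‖
      ≤ (16 * u ^ 8 + 128 * u ^ 14) * (2 * ‖e‖ * t) :=
        mul_le_mul hK hN (norm_nonneg _) hKu0
    _ = ‖e‖ * (32 * u ^ 7 + 256 * (u ^ 6 * u ^ 7)) := by
        linear_combination (‖e‖ * (32 * u ^ 7 + 256 * u ^ 13)) * hut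
    _ ≤ ‖e‖ * (32 * (m⁻¹) ^ 7 + 256 * ((ρ⁻¹) ^ 6 * (m⁻¹) ^ 7)) := by
        have h7 : u ^ 7 ≤ (m⁻¹) ^ 7 := pow_le_pow_left₀ hu0 hum 7
        have h6 : u ^ 6 ≤ (ρ⁻¹) ^ 6 := pow_le_pow_left₀ hu0 huρ 6
        have hm7 : 0 ≤ (m⁻¹) ^ 7 := by positivity
        have hρ6 : 0 ≤ (ρ⁻¹) ^ 6 := by positivity
        have hu6 : 0 ≤ u ^ 6 := by positivity
        refine mul_le_mul_of_nonneg_left ?_ (norm_nonneg _)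
        nlinarith [mul_le_mul h6 h7 (by positivity) hρ6]
    _ = ‖e‖ * (32 + 256 * (ρ⁻¹) ^ 6) * (m⁻¹) ^ 7 := by ring

/-- The complexified summand is holomorphic wherever `Q ≠ 0`. [folklore] -/
theorem hbl_differentiableAt_lineH (w v e : (EuclideanSpace ℝ (Fin 3))) {s₀ : ℂ}
    (hQ : ((‖w‖ ^ 2 : ℝ) : ℂ) + 2 * s₀ * ((⟪w, v⟫_ℝ : ℝ) : ℂ) + s₀ ^ 2 * ((‖v‖ ^ 2 : ℝ) : ℂ) ≠ 0) :
    DifferentiableAt ℂ (fun s : ℂ =>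
      (((((‖w‖ ^ 2 : ℝ) : ℂ) + 2 * s * ((⟪w, v⟫_ℝ : ℝ) : ℂ) + s ^ 2 * ((‖v‖ ^ 2 : ℝ) : ℂ)) ^ 4)⁻¹ -
        ((((‖w‖ ^ 2 : ℝ) : ℂ) + 2 * s * ((⟪w, v⟫_ℝ : ℝ) : ℂ) + s ^ 2 * ((‖v‖ ^ 2 : ℝ) : ℂ)) ^ 7)⁻¹) *
      (((⟪e, w⟫_ℝ : ℝ) : ℂ) + s * ((⟪e, v⟫_ℝ : ℝ) : ℂ))) s₀ := by
  have hQd : DifferentiableAt ℂ (fun s : ℂ =>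
      ((‖w‖ ^ 2 : ℝ) : ℂ) + 2 * s * ((⟪w, v⟫_ℝ : ℝ) : ℂ) + s ^ 2 * ((‖v‖ ^ 2 : ℝ) : ℂ)) s₀ := by
    fun_prop
  have h4 := (hQd.pow 4).inv (pow_ne_zero 4 hQ)
  have h7 := (hQd.pow 7).inv (pow_ne_zero 7 hQ)
  have hN : DifferentiableAt ℂ (fun s : ℂ => ((⟪e, w⟫_ℝ : ℝ) : ℂ) + s * ((⟪e, v⟫_ℝ : ℝ) : ℂ)) s₀ := by
    fun_prop
  exact (h4.sub h7).mul hN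

/-- **Real on the real axis.** For real `σ` the complexified summand equals
`⟪e, K(p + σ v − y)⟫`, `K(z) = ((‖z‖²)⁻⁴ − (‖z‖²)⁻⁷) z`, with `w = p − y`. [folklore] -/
theorem hbl_lineH_ofReal (p v e y : (EuclideanSpace ℝ (Fin 3))) (σ : ℝ) :
    (((((‖p - y‖ ^ 2 : ℝ) : ℂ) + 2 * (σ : ℂ) * ((⟪p - y, v⟫_ℝ : ℝ) : ℂ) +
          (σ : ℂ) ^ 2 * ((‖v‖ ^ 2 : ℝ) : ℂ)) ^ 4)⁻¹ -
        ((((‖p - y‖ ^ 2 : ℝ) : ℂ) + 2 * (σ : ℂ) * ((⟪p - y, v⟫_ℝ : ℝ) : ℂ) +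
          (σ : ℂ) ^ 2 * ((‖v‖ ^ 2 : ℝ) : ℂ)) ^ 7)⁻¹) *
      (((⟪e, p - y⟫_ℝ : ℝ) : ℂ) + (σ : ℂ) * ((⟪e, v⟫_ℝ : ℝ) : ℂ)) =
      ((⟪e, (((‖p + σ • v - y‖ ^ 2) ^ 4)⁻¹ - ((‖p + σ • v - y‖ ^ 2) ^ 7)⁻¹) •
        (p + σ • v - y)⟫_ℝ : ℝ) : ℂ) := by
  have hz : p + σ • v - y = (p - y) + σ • v := by abel
  rw [hz, real_inner_smul_right, inner_add_right, real_inner_smul_right, norm_add_sq_real,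
    real_inner_smul_right, norm_smul, mul_pow, Real.norm_eq_abs, sq_abs]
  push_cast
  ring

end Summit.AtomisticToContinuum.Crystallization.Theorems

end
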